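import Summits.MatrixMultiplication.OmegaCensus.DihedralLikeLawGap
import Summits.MatrixMultiplication.OmegaCensus.DihedralLawComplete
import Summits.MatrixMultiplication.MatrixMultiplication.Theorems.SnSubsetDichotomyPolynomialSlackCosetFibring
import HarnessLib

/-!
# `β(C₂ × D_{2k})` for odd `k`, and the complete table for `C₂ × D_{2k}`

ω-census, family (b3).  Framing: lottery ticket; floor = certified bounds/negative ranges.

For odd `k` the group `C₂ × D_{2k}` (`Multiplicative (ZMod 2) × DihedralGroup k`) is isomorphic to `D_{4k}`
(`A = ℤ₂ × ℤ_k ≅ ℤ_{2k}` is cyclic), so it attains the dihedral-like law `4⌊4k/3⌋`: we push the law triple of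
`DihedralGroup (2k)` (`dihedral_law`) forward along the injective homomorphism
`r i ↦ (i mod 2, r (i mod k))`, `sr i ↦ (i mod 2, sr (i mod k))` (`c2_dihedral_law_odd`).  Together with
`c2_dihedral_law` (`k ≢ 1 (mod 3)`) and `c2_dihedral_law_mod_one` (`k ≡ 4 (mod 6)`, `k ≥ 10`) this completes

**`β(C₂ × D_{2k})` for every `k ≥ 3`, `k ≠ 4`** (`c2_dihedral_law_all`): `8⌊2k/3⌋` if `k ≡ 4 (mod 6)`, and
`4⌊4k/3⌋` otherwise (the two agree unless `k ≡ 1 (mod 3)`).  The excluded `k = 4` (`β(C₂ × D₈) = 16`, census datum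
×2) is below the range `|A| ≥ 14` of the counting argument.
-/

namespace Summit.MatrixMultiplication.OmegaCensus

open Literature.Combinatorics.Additive Finset
open Summit.MatrixMultiplication.MatrixMultiplication.Theorems.PolynomialSlack (tpp_map)

/-- **`β(C₂ × D_{2k}) = 4⌊4k/3⌋` for odd `k ≥ 3`** (then `C₂ × D_{2k} ≅ D_{4k}`). [folklore] -/
theorem c2_dihedral_law_odd {k : ℕ} [NeZero k] (hodd : k % 2 = 1) (hk : 3 ≤ k) :
    (∀ S T U : Finset (Multiplicative (ZMod 2) × DihedralGroup k), TripleProductProperty S T U →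
        S.card * T.card * U.card ≤ 4 * (4 * k / 3)) ∧
    ∃ S T U : Finset (Multiplicative (ZMod 2) × DihedralGroup k), TripleProductProperty S T U ∧
      S.card * T.card * U.card = 4 * (4 * k / 3) := by
  refine ⟨fun S T U h => tpp_volume_le_law_c2_dihedral h, ?_⟩
  haveI : NeZero (2 * k) := ⟨by have := NeZero.ne k; omega⟩
  have hcop : Nat.Coprime 2 k := by
    exact Nat.coprime_two_left.mpr (Nat.odd_iff.2 hodd)
  -- the two reductions `ZMod 2k → ZMod 2`, `ZMod 2k → ZMod k`
  set c₂ : ZMod (2 * k) →+* ZMod 2 := ZMod.castHom (dvd_mul_right 2 k) (ZMod 2) with hc₂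
  set cₖ : ZMod (2 * k) →+* ZMod k := ZMod.castHom (dvd_mul_left k 2) (ZMod k) with hcₖ
  have hcrt : ∀ i j : ZMod (2 * k), c₂ i = c₂ j → cₖ i = cₖ j → i = j := by
    intro i j h1 h2
    apply (ZMod.chineseRemainder hcop).injective
    change (ZMod.cast i : ZMod 2 × ZMod k) = (ZMod.cast j : ZMod 2 × ZMod k)
    ext
    · rw [Prod.fst_zmod_cast, Prod.fst_zmod_cast]; exact h1
    · rw [Prod.snd_zmod_cast, Prod.snd_zmod_cast]; exact h2
  have h2 : ∀ a b : ZMod 2, b - a = a + b := by decide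
  -- the embedding `D_{4k} → C₂ × D_{2k}`
  let f : DihedralGroup (2 * k) → Multiplicative (ZMod 2) × DihedralGroup k := fun g =>
    match g with
    | DihedralGroup.r i => (Multiplicative.ofAdd (c₂ i), DihedralGroup.r (cₖ i))
    | DihedralGroup.sr i => (Multiplicative.ofAdd (c₂ i), DihedralGroup.sr (cₖ i))
  have hf : ∀ x y, f (x * y) = f x * f y := by
    intro x y
    rcases x with i | i <;> rcases y with j | j <;>
      simp only [f, DihedralGroup.r_mul_r, DihedralGroup.r_mul_sr, DihedralGroup.sr_mul_r,
        DihedralGroup.sr_mul_sr, Prod.mk_mul_mk, map_add, map_sub, ← ofAdd_add, h2]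
  let ψ : DihedralGroup (2 * k) →* Multiplicative (ZMod 2) × DihedralGroup k := MonoidHom.mk' f hf
  have hψ : Function.Injective ψ := by
    intro x y hxy
    rcases x with i | i <;> rcases y with j | j <;>
      simp only [ψ, MonoidHom.mk'_apply, f, Prod.mk.injEq, DihedralGroup.r.injEq, DihedralGroup.sr.injEq,
        EmbeddingLike.apply_eq_iff_eq, reduceCtorEq, and_false] at hxy
    · exact congrArg _ (hcrt i j hxy.1 hxy.2)
    · exact congrArg _ (hcrt i j hxy.1 hxy.2)
  obtain ⟨S, T, U, hTPP, hvol⟩ := (dihedral_law (n := 2 * k) (by omega)).2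
  refine ⟨S.map ⟨ψ, hψ⟩, T.map ⟨ψ, hψ⟩, U.map ⟨ψ, hψ⟩, tpp_map ψ hψ hTPP, ?_⟩
  rw [card_map, card_map, card_map, hvol]
  omega

/-- **`β(C₂ × D_{2k})` for every `k ≥ 3`, `k ≠ 4`**: `8⌊2k/3⌋` if `k ≡ 4 (mod 6)` and the dihedral-like law
`4⌊4k/3⌋` otherwise (`c2_dihedral_law`, `c2_dihedral_law_mod_one`, `c2_dihedral_law_odd`). [folklore] -/
theorem c2_dihedral_law_all {k : ℕ} [NeZero k] (hk : 3 ≤ k) (hk4 : k ≠ 4) :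
    (∀ S T U : Finset (Multiplicative (ZMod 2) × DihedralGroup k), TripleProductProperty S T U →
        S.card * T.card * U.card ≤ if k % 6 = 4 then 8 * (2 * k / 3) else 4 * (4 * k / 3)) ∧
    ∃ S T U : Finset (Multiplicative (ZMod 2) × DihedralGroup k), TripleProductProperty S T U ∧
      S.card * T.card * U.card = if k % 6 = 4 then 8 * (2 * k / 3) else 4 * (4 * k / 3) := by
  by_cases h6 : k % 6 = 4
  · rw [if_pos h6]
    exact c2_dihedral_law_mod_one (k := k) (by omega) (by omega) (by omega)
  · rw [if_neg h6]
    by_cases h3 : k % 3 = 1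
    · exact c2_dihedral_law_odd (by omega) hk
    · exact c2_dihedral_law hk h3

end Summit.MatrixMultiplication.OmegaCensus
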